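import Literature.NumberTheory.EllipticCurves.QuadraticTwistKroneckerLFunctionProofs
import Literature.NumberTheory.DiophantineGeometry.LocalReductionHasMultiplicativeReductionAtProofs
import HarnessLib

/-!
# A quadratic twist by `D` with `ord_v(D)` odd of a curve of good reduction is additive at `v`

Let `E / ℚ` be an elliptic curve with good reduction at the finite place `v` and `D ∈ ℚ` with
`ord_v(D)` **odd**. Then the quadratic twist `E^{(D)}` (`WeierstrassCurve.quadraticTwist`) has
additive reduction at `v` (`hasAdditiveReductionAt_quadraticTwist_of_valuation_eq_exp_odd`), at
*every* residue characteristic including `2`. The proof only uses the invariants `c₄`, `Δ` of a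
minimal model (Silverman, *AEC* VII.1, Prop. 1.3 and VII.5, Prop. 5.1): if `W₁` is a minimal model
of `E` at `v` (`v(Δ₁) = 0`, `v(c₄(W₁)) ≥ 0`) then every model `Y` of `E^{(D)}` over `ℚ_v` has
`Δ(Y) = u⁻¹² D⁶ Δ₁`, `c₄(Y) = u⁻⁴ D² c₄(W₁)` for some `u ∈ ℚ_vˣ`, so `v(Δ(Y)) ≡ 6 v(D) ≢ 0 (mod 12)`
rules out good reduction, and `v(c₄(Y)) = 0` would force `v(Δ(Y)) = 3 v(c₄(W₁)) ≥ 0` together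
with `v(Δ(Y)) > 0`... more precisely `12 v(u) = 6 v(D) + 3 v(c₄(W₁))` and then
`v(Δ(Y)) = −3 v(c₄(W₁)) ≤ 0`, ruling out multiplicative reduction. (For `v ∤ 2` and `ord_v(D) = 1`
this is the additivity at the ramified primes of `QuadraticTwistKroneckerLFunctionProofs`; the point
of the present valuation-only argument is the place over `2`, e.g. the twists by `d_K = 8m'` of a
curve of good reduction at `2`. The remaining dyadic case `ord₂(D)` even, `D/4 ≡ 3 (mod 4)`, is *not*
decided by `c₄`, `Δ` alone and is not treated here.)

Everything is proved; no definitions and no named facts.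

## References

* J. H. Silverman, *The Arithmetic of Elliptic Curves*, 2nd ed. 2009, VII.1 Prop. 1.3, VII.5 Prop. 5.1,
  X.2 Prop. 2.4 (twists).
-/

noncomputable section

open scoped Classical

namespace WeierstrassCurve

open IsDedekindDomain IsDedekindDomain.HeightOneSpectrum NumberField

/-- **A twist by `D` with `ord_v(D)` odd of a curve of good reduction at `v` has additive reduction
at `v`** (any residue characteristic): with `W₁` the local minimal model of `W` at `v`
(`v(Δ₁) = 0`), the local minimal model `Y` of `W^{(D)}` is `C • W₁^{(D)}` for a change of variables
`C` over `ℚ_v`, so `Δ(Y) = u⁻¹² D⁶ Δ₁` and `c₄(Y) = u⁻⁴ D² c₄(W₁)`; `v(Δ(Y)) = 0` is impossible as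
`6 · ord_v(D)` is not a multiple of `12`, and `v(c₄(Y)) = 0`, `v(Δ(Y)) > 0` are incompatible with
`v(c₄(W₁)) ≥ 0` (Silverman, *AEC* VII.1 Prop. 1.3, VII.5 Prop. 5.1). [cite: SilvermanAEC2009, VII.5 Prop. 5.1] -/
theorem hasAdditiveReductionAt_quadraticTwist_of_valuation_eq_exp_odd (W : WeierstrassCurve ℚ)
    [W.IsElliptic] (v : HeightOneSpectrum (𝓞 ℚ)) {D : ℚ} {e : ℕ} (he : Odd e)
    (hD : v.valuation ℚ D = WithZero.exp (-(e : ℤ))) (hgood : W.HasGoodReductionAt v) :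
    (W.quadraticTwist D).HasAdditiveReductionAt v := by
  set Kv := v.adicCompletion ℚ with hKv
  set O := v.adicCompletionIntegers ℚ with hO
  haveI : NeZero (2 : Kv) := ⟨by
    rw [← map_ofNat (algebraMap ℚ Kv) 2]; exact (map_ne_zero _).mpr two_ne_zero⟩
  have hD0 : D ≠ 0 := by
    intro h
    rw [h, map_zero] at hD
    exact WithZero.exp_ne_zero hD.symm
  haveI := W.isElliptic_quadraticTwist hD0
  -- the local minimal models
  set W₁ := W.localMinimalModel v with hW₁
  haveI : W₁.IsElliptic := W.isElliptic_localMinimalModel v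
  obtain ⟨C₁, hC₁⟩ : ∃ C : VariableChange Kv, W₁ = C • W.baseChange Kv := ⟨_, rfl⟩
  set Y := (W.quadraticTwist D).localMinimalModel v with hYdef
  obtain ⟨C, hC⟩ : ∃ C : VariableChange Kv, Y = C • (W.quadraticTwist D).baseChange Kv := ⟨_, rfl⟩
  have htwK : (W.quadraticTwist D).baseChange Kv = (W.baseChange Kv).quadraticTwist (D : Kv) := by
    rw [baseChange, map_quadraticTwist, eq_ratCast]
    rfl
  have hWb : W.baseChange Kv = C₁⁻¹ • W₁ := by rw [hC₁, inv_smul_smul]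
  set C' : VariableChange Kv := C * ⟨C₁⁻¹.u, (D : Kv) * C₁⁻¹.r, 0, 0⟩ with hC'
  have hY : Y = C' • W₁.quadraticTwist (D : Kv) := by
    rw [hC, htwK, hWb, quadraticTwist_smul, hC', mul_smul]
  have hΔY : Y.Δ = (↑C'.u⁻¹ : Kv) ^ 12 * ((D : Kv) ^ 6 * W₁.Δ) := by
    rw [hY, variableChange_Δ, quadraticTwist_Δ]
  have hc₄Y : Y.c₄ = (↑C'.u⁻¹ : Kv) ^ 4 * ((D : Kv) ^ 2 * W₁.c₄) := by
    rw [hY, variableChange_c₄, quadraticTwist_c₄]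
  -- valuations, read in `Valued.v`
  have hE := isEquiv_valuation_maximalIdeal_valued v (K := ℚ)
  have hvD : Valued.v (D : Kv) = WithZero.exp (-(e : ℤ)) := by
    rw [show (D : Kv) = algebraMap ℚ Kv D from (eq_ratCast _ D).symm, valued_algebraMap_adicCompletion,
      hD]
  have hΔ₁ : Valued.v W₁.Δ = 1 := hE.eq_one_iff_eq_one.mp hgood.goodReduction
  have hc₄₁ : Valued.v W₁.c₄ ≤ 1 :=
    (valued_le_one_iff_mem_range_adicCompletionIntegers v _).mpr ⟨_, integralModel_c₄_eq O W₁⟩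
  obtain ⟨k, hk⟩ : ∃ k : ℤ, Valued.v (↑C'.u⁻¹ : Kv) = WithZero.exp k :=
    ⟨_, (WithZero.exp_log ((Valuation.ne_zero_iff _).mpr (Units.ne_zero _))).symm⟩
  have hvΔY : Valued.v Y.Δ = WithZero.exp (12 • k + 6 • (-(e : ℤ))) := by
    rw [hΔY, map_mul, map_mul, map_pow, map_pow, hk, hvD, hΔ₁, mul_one, WithZero.exp_add,
      WithZero.exp_nsmul, WithZero.exp_nsmul]
  obtain ⟨r, hr⟩ := he
  -- trichotomy for the minimal model `Y`
  rcases hasGoodReduction_or_hasMultiplicativeReduction_or_hasAdditiveReduction O (W := Y) with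
    hg | hm | ha
  · exfalso
    have h1 : Valued.v Y.Δ = 1 := hE.eq_one_iff_eq_one.mp hg.goodReduction
    rw [hvΔY, WithZero.exp_eq_one] at h1
    simp only [nsmul_eq_mul, Nat.cast_ofNat] at h1
    omega
  · exfalso
    have h1 : Valued.v Y.c₄ = 1 := hE.eq_one_iff_eq_one.mp hm.multiplicativeReduction
    have h2 : Valued.v Y.Δ < 1 := hE.lt_one_iff_lt_one.mp hm.badReduction
    by_cases hc0 : W₁.c₄ = 0
    · rw [hc₄Y, hc0, mul_zero, mul_zero, map_zero] at h1
      exact zero_ne_one h1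
    · obtain ⟨c, hc⟩ : ∃ c : ℤ, Valued.v W₁.c₄ = WithZero.exp c :=
        ⟨_, (WithZero.exp_log ((Valuation.ne_zero_iff _).mpr hc0)).symm⟩
      rw [hc, ← WithZero.exp_zero, WithZero.exp_le_exp] at hc₄₁
      rw [hc₄Y, map_mul, map_mul, map_pow, map_pow, hk, hvD, hc, ← WithZero.exp_nsmul,
        ← WithZero.exp_nsmul, ← WithZero.exp_add, ← WithZero.exp_add, WithZero.exp_eq_one] at h1
      rw [hvΔY, ← WithZero.exp_zero, WithZero.exp_lt_exp] at h2
      simp only [nsmul_eq_mul, Nat.cast_ofNat] at h1 h2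
      omega
  · exact ha

/-- The dyadic case of interest: for `D = 8 m'` with `m'` odd (e.g. an even fundamental
discriminant `d_K = 8m'`) and `W` with good reduction at the place `v` over `2`, the twist `W^{(D)}`
has additive reduction at `v` (`ord₂(D) = 3` is odd). [cite: SilvermanAEC2009, VII.5 Prop. 5.1] -/
theorem hasAdditiveReductionAt_quadraticTwist_eight_mul (W : WeierstrassCurve ℚ) [W.IsElliptic]
    (v : HeightOneSpectrum (𝓞 ℚ)) (hv2 : (Rat.HeightOneSpectrum.primesEquiv v : ℕ) = 2) {m' : ℤ}
    (hm' : Odd m') (hgood : W.HasGoodReductionAt v) :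
    (W.quadraticTwist ((8 * m' : ℤ) : ℚ)).HasAdditiveReductionAt v := by
  have h2 : v.valuation ℚ (2 : ℚ) = WithZero.exp (-1 : ℤ) := by
    have h := valuation_ringOfIntegers_natCast_primesEquiv v
    rw [hv2] at h
    exact_mod_cast h
  have hm2 : ¬ ((Rat.HeightOneSpectrum.primesEquiv v : ℕ) : ℤ) ∣ m' := by
    rw [hv2]
    intro h
    exact (Int.not_even_iff_odd.mpr hm') (even_iff_two_dvd.mpr (by exact_mod_cast h))
  have hvm : v.valuation ℚ (m' : ℚ) = 1 := valuation_ringOfIntegers_intCast_eq_one v hm2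
  refine W.hasAdditiveReductionAt_quadraticTwist_of_valuation_eq_exp_odd v (e := 3) (by decide) ?_ hgood
  push_cast
  rw [show (8 : ℚ) * m' = 2 ^ 3 * m' by norm_num, map_mul, map_pow, h2, hvm, mul_one,
    ← WithZero.exp_nsmul]
  norm_num

end WeierstrassCurve

end
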